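import Literature.RingTheory.CohomologyAnnihilator.TowerRestrict
import Mathlib.RingTheory.Flat.Basic
import Mathlib.RingTheory.TensorProduct.Finite
import Mathlib.LinearAlgebra.TensorProduct.RightExactness
import HarnessLib

/-!
# Syzygies under a flat base change

Topic: `Literature/RingTheory/CohomologyAnnihilator`. The base change step of the proof of
[IyengarTakahashi2014, Theorem 5.4] ("The `R`-module `Ω^d_R M` is a direct summand of
`(Ω^d_R M) ⊗ₖ K ≅ Ω^d_{R ⊗ₖ K}(M ⊗ₖ K)`"), in the vocabulary of `StrongGenerator.lean` and for a
general flat algebra `A → B`: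

* `IsSyzygy.baseChange` — if `B` is flat over `A` and `K` is an `s`-th syzygy of `M` over `A`,
  then `B ⊗_A K` is an `s`-th syzygy of `B ⊗_A M` over `B` (flat base change is exact and sends
  finitely generated projectives to finitely generated projectives);
* `exists_retract_baseChange` — if the structure map `A → B` admits an `A`-linear retraction
  `r : B → A` (e.g. `B = K ⊗ₖ A` for a field extension `K/k`), then every `A`-module `N` is a
  direct summand of `(B ⊗_A N)|_A` (`n ↦ 1 ⊗ n`, retracted by `r ⊗ N`).

## References

* S. B. Iyengar, R. Takahashi, *Annihilation of cohomology and strong generation of module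
  categories*, IMRN 2016; arXiv:1404.1476 — proof of Theorem 5.4. [`IyengarTakahashi2014`]
-/

noncomputable section

open CategoryTheory CategoryTheory.Limits
open scoped TensorProduct

universe u

namespace Literature.RingTheory.CohomologyAnnihilator

variable {A : Type u} [CommRing A] (B : Type u) [CommRing B] [Algebra A B]

/-! ## Flat base change of syzygies -/

/-- Flat base change of a short exact sequence of `A`-modules is a short exact sequence of
`B`-modules. [folklore] -/
private theorem exists_shortExact_baseChange [Module.Flat A B] {Y M X : ModuleCat.{u} A}
    {f : Y ⟶ M} {g : M ⟶ X} {w : f ≫ g = 0} (hS : (ShortComplex.mk f g w).ShortExact) :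
    ∃ w' : ModuleCat.ofHom (X := ModuleCat.of B (B ⊗[A] Y)) (Y := ModuleCat.of B (B ⊗[A] M))
          (f.hom.baseChange B) ≫
        ModuleCat.ofHom (X := ModuleCat.of B (B ⊗[A] M)) (Y := ModuleCat.of B (B ⊗[A] X))
          (g.hom.baseChange B) = 0,
      (ShortComplex.mk _ _ w').ShortExact := by
  obtain ⟨hf, hg, hfg⟩ := shortExact_unpack hS
  refine exists_shortExact_of_linearMap (Y := ModuleCat.of B (B ⊗[A] Y))
    (M := ModuleCat.of B (B ⊗[A] M)) (X := ModuleCat.of B (B ⊗[A] X)) (f.hom.baseChange B)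
    (g.hom.baseChange B) ?_ ?_ ?_
  · change Function.Injective (f.hom.baseChange B : B ⊗[A] Y → B ⊗[A] M)
    rw [LinearMap.baseChange_eq_ltensor]
    exact Module.Flat.lTensor_preserves_injective_linearMap f.hom hf
  · change Function.Surjective (g.hom.baseChange B : B ⊗[A] M → B ⊗[A] X)
    rw [LinearMap.baseChange_eq_ltensor]
    exact LinearMap.lTensor_surjective B hg
  · change Function.Exact (f.hom.baseChange B : B ⊗[A] Y → B ⊗[A] M)
      (g.hom.baseChange B : B ⊗[A] M → B ⊗[A] X)
    rw [LinearMap.baseChange_eq_ltensor, LinearMap.baseChange_eq_ltensor]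
    exact lTensor_exact B hfg hg

/-- **Flat base change of syzygies**: if `B` is a flat `A`-algebra and `K` is an `s`-th syzygy
module of `M` over `A`, then `B ⊗_A K` is an `s`-th syzygy module of `B ⊗_A M` over `B` (each
defining sequence `0 → K → P → K' → 0` stays exact, and `B ⊗_A P` is finitely generated projective
over `B`). This is the isomorphism "`(Ω^d_R M) ⊗ₖ K ≅ Ω^d_{R ⊗ₖ K}(M ⊗ₖ K)`" of the proof of
Theorem 5.4 in the form "a base-changed syzygy is a syzygy of the base change".
[cite: IyengarTakahashi2014, Thm. 5.4 (proof)] -/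
theorem IsSyzygy.baseChange [Module.Flat A B] :
    ∀ (s : ℕ) {M K : ModuleCat.{u} A}, IsSyzygy s M K →
      IsSyzygy s (ModuleCat.of B (B ⊗[A] M)) (ModuleCat.of B (B ⊗[A] K))
  | 0, _, _, ⟨e⟩ => ⟨(LinearEquiv.baseChange A B _ _ e.toLinearEquiv).toModuleIso⟩
  | s + 1, M, K, ⟨K', P, hK', hP, hproj, f, g, w, hS⟩ => by
    haveI := hP
    haveI := moduleProjective_of_projective P hproj
    obtain ⟨w', hS'⟩ := exists_shortExact_baseChange B hS
    exact ⟨ModuleCat.of B (B ⊗[A] K'), ModuleCat.of B (B ⊗[A] P), IsSyzygy.baseChange s hK',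
      Module.Finite.base_change A B P,
      (IsProjective.iff_projective (R := B) (B ⊗[A] P)).mp inferInstance, _, _, w', hS'⟩

/-! ## Morphisms into and out of a restriction of scalars -/

/-- A morphism INTO a restricted module `M|_A` (along `f : A → S`) from an additive map
`g : Y → M` with `g (a • y) = f a • g y`. [folklore] -/
private theorem exists_hom_to_restrictScalars {S : Type u} [CommRing S] (f : A →+* S)
    (Y : ModuleCat.{u} A) (M : ModuleCat.{u} S) (g : Y →+ M)
    (hg : ∀ (a : A) (y : Y), g (a • y) = f a • g y) :
    ∃ j : Y ⟶ (ModuleCat.restrictScalars f).obj M, ∀ y : Y, j.hom y = g y :=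
  ⟨ModuleCat.ofHom (Y := (ModuleCat.restrictScalars f).obj M)
    { toFun := g
      map_add' := g.map_add
      map_smul' := fun a y => hg a y }, fun _ => rfl⟩

/-- A morphism OUT OF a restricted module `M|_A` (along `f : A → S`) from an additive map
`g : M → Y` with `g (f a • m) = a • g m`. [folklore] -/
private theorem exists_hom_from_restrictScalars {S : Type u} [CommRing S] (f : A →+* S)
    (M : ModuleCat.{u} S) (Y : ModuleCat.{u} A) (g : M →+ Y)
    (hg : ∀ (a : A) (m : M), g (f a • m) = a • g m) :
    ∃ q : (ModuleCat.restrictScalars f).obj M ⟶ Y, ∀ m : M, q.hom m = g m :=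
  ⟨ModuleCat.ofHom (X := (ModuleCat.restrictScalars f).obj M)
    { toFun := g
      map_add' := g.map_add
      map_smul' := fun a m => hg a m }, fun _ => rfl⟩

/-! ## The splitting of `N → (B ⊗_A N)|_A` -/

/-- **Splitting of the base change**: if the structure map `A → B` has an `A`-linear retraction
`r` (`r 1 = 1`), then every `A`-module `N` is a retract of the restriction to `A` of the
`B`-module `B ⊗_A N`: `n ↦ 1 ⊗ n` is split by `b ⊗ n ↦ r(b) n`. (In the proof of Theorem 5.4:
"the `R`-module `Ω^d_R M` is a direct summand of `(Ω^d_R M) ⊗ₖ K`", `K/k` a field extension.)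
[cite: IyengarTakahashi2014, Thm. 5.4 (proof)] -/
theorem exists_retract_baseChange (r : B →ₗ[A] A) (hr : r 1 = 1) (N : ModuleCat.{u} A) :
    ∃ (i : N ⟶ (restrictScalarsFunctor A B).obj (ModuleCat.of B (B ⊗[A] N)))
      (p : (restrictScalarsFunctor A B).obj (ModuleCat.of B (B ⊗[A] N)) ⟶ N), i ≫ p = 𝟙 N := by
  let p₀ : B ⊗[A] N →ₗ[A] N := (TensorProduct.lid A N).toLinearMap ∘ₗ r.rTensor N
  have hp₀ : ∀ (b : B) (n : N), p₀ (b ⊗ₜ[A] n) = r b • n := fun b n => by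
    change TensorProduct.lid A N (r.rTensor N (b ⊗ₜ[A] n)) = r b • n
    rw [LinearMap.rTensor_tmul, TensorProduct.lid_tmul]
  obtain ⟨i, hi⟩ := exists_hom_to_restrictScalars (algebraMap A B) N
    (ModuleCat.of B (B ⊗[A] N)) (TensorProduct.mk A B N 1).toAddMonoidHom (fun a n => by
      change ((1 : B) ⊗ₜ[A] (a • n) : B ⊗[A] N) = algebraMap A B a • ((1 : B) ⊗ₜ[A] n)
      rw [algebraMap_smul, TensorProduct.tmul_smul])
  obtain ⟨p, hp⟩ := exists_hom_from_restrictScalars (algebraMap A B)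
    (ModuleCat.of B (B ⊗[A] N)) N p₀.toAddMonoidHom (fun a x => by
      change p₀ (algebraMap A B a • (x : B ⊗[A] N)) = a • p₀ x
      rw [algebraMap_smul, map_smul])
  refine ⟨i, p, ?_⟩
  apply ModuleCat.hom_ext
  refine LinearMap.ext fun n => ?_
  change p.hom (i.hom n) = n
  rw [hi, hp]
  change p₀ ((1 : B) ⊗ₜ[A] n) = n
  rw [hp₀, hr, one_smul]

end Literature.RingTheory.CohomologyAnnihilator

end
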